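import Summits.CriticalPhenomena.Ising3DConformalLimit.Theorems.MoebiusLimitExists.Negative.InversionContent
import Summits.CriticalPhenomena.Ising3DConformalLimit.Theorems.HyperoctahedralRPTwoPointLimitIsotropicHolds
import Summits.CriticalPhenomena.Ising3DConformalLimit.Theorems.EnergyNotSigmaSquaredMoebiusLimitExistsOneMapOneJetDefs
import Literature.Probability.LatticeModels.ConformalCovariance
import HarnessLib

/-!
# Line `one-map-one-jet` (crux `MoebiusLimitExists`, stmt-CriticalPhenomena-1344): the inversion defect of a
1981-type limit vanishes identically at orders `n ≤ 3` and at every odd order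

For every normalised, non-degenerate, translation-invariant, scale-covariant pointwise scaling limit `S`
of the critical `ℤ³` Ising correlators (the hypotheses of item stmt-CriticalPhenomena-1981
`HyperoctahedralRP.ExistsScaleCovariantLimit`, NO rotations) the inversion defect
`D_n(x) = S n (ι x) − (∏‖x i‖^{2Δ}) S n x` vanishes at every configuration avoiding the pole whenever
`n = 0` (`S₀` is `ι`-blind), `n` is odd (`S_n ≡ 0`, tree `limit_odd_eq_zero'`), or `n = 2`
(two-point isotropy is a THEOREM for such limits — `twoPointLimitIsotropic_proof`, item 1984, through
`HRP2Rigidity_of` — so `S₂(p,q) = A‖p − q‖^{-2Δ}`, and `‖ιp − ιq‖ = ‖p − q‖/(‖p‖‖q‖)`).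
Consequently the residual stub `stub_inversionGermOfAnalyticLimit` of the line only has content at the
EVEN orders `n ≥ 4` (skeleton v3: `stub_inversionGerm_even_ge_four`), exactly as for the sibling line
`only-interaction-breaks-moebius` (`moebiusLimit_iff_rotation_inversion_ge_four`).
-/

noncomputable section

open Set Function Filter EuclideanGeometry
open scoped Topology
open Literature.Probability.LatticeModels

namespace Summit.CriticalPhenomena.Ising3DConformalLimit.MoebiusLimitExistsOneMapOneJet

/-! ## Two-point structure of a 1981-type limit (no rotation hypothesis) -/

open Summit.CriticalPhenomena.Ising3DConformalLimit.MoebiusLimitExistsNegative (eq_vec_two limit_two_eq_of_sub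
  limit_odd_eq_zero')

/-- Radial form of the two-point function from TWO-POINT isotropy only (no `IsRotationInvariant S`):
`S₂(0, y) = ‖y‖^{-2Δ} S₂(0, e₀)` for `y ≠ 0`. [cite: FrancescoMathieuSenechal1997, §4.3.1 eq. (4.55)] -/
theorem two_point_radial_of_iso {Δ : ℝ} {S : CorrFamily 3}
    (hiso : ∀ (R : EuclideanSpace ℝ (Fin 3) ≃ₗᵢ[ℝ] EuclideanSpace ℝ (Fin 3)) (x : EuclideanSpace ℝ (Fin 3)),
      x ≠ 0 → S 2 ![0, R x] = S 2 ![0, x])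
    (hsc : IsScaleCovariant Δ S) {y : EuclideanSpace ℝ (Fin 3)} (hy : y ≠ 0) :
    S 2 ![0, y] = ‖y‖ ^ (-(2:ℝ) * Δ) * S 2 ![0, EuclideanSpace.single 0 1] := by
  set v : EuclideanSpace ℝ (Fin 3) := EuclideanSpace.single 0 1 with hv
  set t : ℝ := ‖y‖ with ht
  have htpos : 0 < t := norm_pos_iff.2 hy
  set u : EuclideanSpace ℝ (Fin 3) := t⁻¹ • y with hu
  have hvn : ‖v‖ = 1 := by simp [hv]
  have hun : ‖u‖ = 1 := by
    rw [hu, norm_smul, norm_inv, Real.norm_of_nonneg htpos.le, ← ht, inv_mul_cancel₀ htpos.ne']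
  set R := (Submodule.span ℝ {v - u})ᗮ.reflection with hR
  have hRv : R v = u := Submodule.reflection_sub (by rw [hvn, hun])
  have htv : t • v ≠ 0 := smul_ne_zero htpos.ne' (by rw [← norm_ne_zero_iff, hvn]; exact one_ne_zero)
  have h1 := hiso R (t • v) htv
  have hRtv : R (t • v) = y := by
    rw [map_smul, hRv, hu, smul_smul, mul_inv_cancel₀ htpos.ne', one_smul]
  rw [hRtv] at h1
  have h2 := hsc 2 t htpos ![0, v]
  have hcfg2 : (fun i => t • (![0, v] : Fin 2 → EuclideanSpace ℝ (Fin 3)) i) = ![0, t • v] := by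
    funext i; fin_cases i <;> simp
  rw [hcfg2] at h2
  rw [h1, h2]
  push_cast
  ring_nf

/-- **`D₂ ≡ 0`**: the two-point inversion defect of a non-degenerate, translation-invariant,
scale-covariant pointwise limit of the critical `ℤ³` correlators vanishes at every pair avoiding the pole
(two-point isotropy is the tree theorem `twoPointLimitIsotropic_proof`; then `S₂(p,q) = A‖p−q‖^{-2Δ}` and
`‖ιp − ιq‖ = ‖p − q‖/(‖p‖‖q‖)`; at a coincident pair both values vanish by normalisation).
[cite: FrancescoMathieuSenechal1997, §4.3.1 eq. (4.55)] -/
theorem inversionDefect_two_eq_zero {ρ : ℝ → ℝ} {Δ : ℝ} {S : CorrFamily 3}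
    (hρ : ∀ δ ∈ Set.Ioc (0:ℝ) 1, 0 < ρ δ) (hlim : HasPointwiseScalingLimit (criticalCorr 3) ρ S)
    (hnorm : ∀ n z, z ∉ NonCoincident 3 n → S n z = 0) (hnd : IsNondegenerateTwoPoint S)
    (htr : IsTranslationInvariant S) (hsc : IsScaleCovariant Δ S)
    (x : Fin 2 → EuclideanSpace ℝ (Fin 3)) (hx0 : ∀ i, x i ≠ 0) : inversionDefect Δ S 2 x = 0 := by
  by_cases hx : x ∈ NonCoincident 3 2
  · have hiso := Summit.CriticalPhenomena.Ising3DConformalLimit.HyperoctahedralRPTwoPoint.twoPointLimitIsotropic_proof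
      ρ Δ S hρ hlim hnd htr hsc
    have hinj : Function.Injective x := hx
    have hne : x 0 ≠ x 1 := hinj.ne (by decide)
    have hιne : inversion (0 : EuclideanSpace ℝ (Fin 3)) 1 (x 0) ≠ inversion 0 1 (x 1) :=
      fun h => hne (inversion_injective _ one_ne_zero h)
    have hsub : x 1 - x 0 ≠ 0 := sub_ne_zero.2 hne.symm
    have hιsub : inversion (0 : EuclideanSpace ℝ (Fin 3)) 1 (x 1) - inversion 0 1 (x 0) ≠ 0 :=
      sub_ne_zero.2 hιne.symm
    have hR : S 2 x = ‖x 1 - x 0‖ ^ (-(2:ℝ) * Δ) * S 2 ![0, EuclideanSpace.single 0 1] := by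
      rw [congrArg (S 2) (eq_vec_two x), limit_two_eq_of_sub hlim hne, two_point_radial_of_iso hiso hsc hsub]
    have hL : S 2 (invCfg x) =
        ‖inversion (0 : EuclideanSpace ℝ (Fin 3)) 1 (x 1) - inversion 0 1 (x 0)‖ ^ (-(2:ℝ) * Δ) *
          S 2 ![0, EuclideanSpace.single 0 1] := by
      have e : invCfg x = ![inversion 0 1 (x 0), inversion 0 1 (x 1)] := by
        funext i; fin_cases i <;> rfl
      rw [e, limit_two_eq_of_sub hlim hιne, two_point_radial_of_iso hiso hsc hιsub]
    have hdist : ‖inversion (0 : EuclideanSpace ℝ (Fin 3)) 1 (x 1) - inversion 0 1 (x 0)‖ =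
        ‖x 1 - x 0‖ / (‖x 1‖ * ‖x 0‖) := by
      rw [← dist_eq_norm, dist_inversion_inversion (hx0 1) (hx0 0), dist_eq_norm, dist_eq_norm,
        dist_eq_norm, sub_zero, sub_zero, one_pow, div_mul_eq_mul_div, one_mul]
    have h0 : 0 < ‖x 0‖ := norm_pos_iff.2 (hx0 0)
    have h1 : 0 < ‖x 1‖ := norm_pos_iff.2 (hx0 1)
    have hd : 0 < ‖x 1 - x 0‖ := norm_pos_iff.2 hsub
    rw [inversionDefect, sub_eq_zero, hL, hR, hdist, Fin.prod_univ_two, Real.div_rpow hd.le (by positivity),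
      Real.mul_rpow h1.le h0.le]
    have e1 : ‖x 1‖ ^ (-(2:ℝ) * Δ) = (‖x 1‖ ^ (2 * Δ))⁻¹ := by
      rw [show (-(2:ℝ) * Δ) = -(2 * Δ) by ring, Real.rpow_neg h1.le]
    have e0 : ‖x 0‖ ^ (-(2:ℝ) * Δ) = (‖x 0‖ ^ (2 * Δ))⁻¹ := by
      rw [show (-(2:ℝ) * Δ) = -(2 * Δ) by ring, Real.rpow_neg h0.le]
    rw [e1, e0]
    have hp0 : 0 < ‖x 0‖ ^ (2 * Δ) := Real.rpow_pos_of_pos h0 _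
    have hp1 : 0 < ‖x 1‖ ^ (2 * Δ) := Real.rpow_pos_of_pos h1 _
    field_simp
  · have hι : invCfg x ∉ NonCoincident 3 2 := fun h => hx ((invCfg_mem_nonCoincident_iff x).1 h)
    rw [inversionDefect, hnorm 2 x hx, hnorm 2 _ hι, mul_zero, sub_zero]

/-- **`D₀ ≡ 0`**: at order `0` the inversion defect of ANY family vanishes (the empty configuration is
`ι`-fixed and its weight is the empty product). [folklore] -/
theorem inversionDefect_zero_eq_zero (Δ : ℝ) (S : CorrFamily 3) (x : Fin 0 → EuclideanSpace ℝ (Fin 3)) :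
    inversionDefect Δ S 0 x = 0 := by
  have h : invCfg x = x := funext fun i => Fin.elim0 i
  simp [inversionDefect, h]

/-- **`D_n ≡ 0` for odd `n`**: odd correlators of any pointwise limit of the critical `ℤ³` correlators
vanish on `NonCoincident` (tree `limit_odd_eq_zero'`), and off it by normalisation; `ι` preserves both.
[cite: AizenmanDuminilCopinSidoraviciusCMP2015, Thm. 1.2] -/
theorem inversionDefect_odd_eq_zero {ρ : ℝ → ℝ} (Δ : ℝ) {S : CorrFamily 3}
    (hlim : HasPointwiseScalingLimit (criticalCorr 3) ρ S)
    (hnorm : ∀ n z, z ∉ NonCoincident 3 n → S n z = 0) {n : ℕ} (hn : Odd n)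
    (x : Fin n → EuclideanSpace ℝ (Fin 3)) : inversionDefect Δ S n x = 0 := by
  have hS : ∀ z : Fin n → EuclideanSpace ℝ (Fin 3), S n z = 0 := fun z => by
    by_cases hz : z ∈ NonCoincident 3 n
    · exact limit_odd_eq_zero' hlim hn hz
    · exact hnorm n z hz
  rw [inversionDefect, hS, hS, mul_zero, sub_zero]

/-- **The inversion defect of a 1981-type limit only lives at even orders `≥ 4`**: for every normalised,
non-degenerate, translation-invariant, scale-covariant pointwise scaling limit of the critical `ℤ³`
correlators, `D_n(x) = 0` at every configuration avoiding the pole whenever `n < 4` or `n` is odd.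
[folklore] -/
theorem inversionDefect_eq_zero_of_lt_four_or_odd' {ρ : ℝ → ℝ} {Δ : ℝ} {S : CorrFamily 3}
    (hρ : ∀ δ ∈ Set.Ioc (0:ℝ) 1, 0 < ρ δ) (hlim : HasPointwiseScalingLimit (criticalCorr 3) ρ S)
    (hnorm : ∀ n z, z ∉ NonCoincident 3 n → S n z = 0) (hnd : IsNondegenerateTwoPoint S)
    (htr : IsTranslationInvariant S) (hsc : IsScaleCovariant Δ S)
    {n : ℕ} (hn : n < 4 ∨ Odd n) (x : Fin n → EuclideanSpace ℝ (Fin 3)) (hx0 : ∀ i, x i ≠ 0) :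
    inversionDefect Δ S n x = 0 := by
  rcases Nat.even_or_odd n with he | ho
  · have hlt : n < 4 := hn.resolve_right (Nat.not_odd_iff_even.2 he)
    obtain ⟨k, rfl⟩ := he
    have hk : k = 0 ∨ k = 1 := by omega
    rcases hk with rfl | rfl
    · exact inversionDefect_zero_eq_zero Δ S x
    · exact inversionDefect_two_eq_zero hρ hlim hnorm hnd htr hsc x hx0
  · exact inversionDefect_odd_eq_zero Δ hlim hnorm ho x

/-- **Registered anchor of this file** (`inversionDefect_eq_zero_of_lt_four_or_odd`, explicit-binder form):
for every normalised, non-degenerate, translation-invariant, scale-covariant pointwise scaling limit of the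
critical `ℤ³` correlators (the data of item stmt-CriticalPhenomena-1981), the inversion defect vanishes at
every configuration avoiding the pole at all orders `n < 4` and at all odd orders — so the residual of line
`one-map-one-jet` lives at the even orders `n ≥ 4` only. [folklore] -/
theorem inversionDefect_eq_zero_of_lt_four_or_odd :
    ∀ (ρ : ℝ → ℝ) (Δ : ℝ) (S : CorrFamily 3), (∀ δ ∈ Set.Ioc (0:ℝ) 1, 0 < ρ δ) →
      HasPointwiseScalingLimit (criticalCorr 3) ρ S →
      (∀ n z, z ∉ NonCoincident 3 n → S n z = 0) → IsNondegenerateTwoPoint S →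
      IsTranslationInvariant S → IsScaleCovariant Δ S →
      ∀ n, (n < 4 ∨ Odd n) → ∀ x : Fin n → EuclideanSpace ℝ (Fin 3), (∀ i, x i ≠ 0) →
        inversionDefect Δ S n x = 0 :=
  fun _ _ _ hρ hlim hnorm hnd htr hsc _ hn x hx0 =>
    inversionDefect_eq_zero_of_lt_four_or_odd' hρ hlim hnorm hnd htr hsc hn x hx0

end Summit.CriticalPhenomena.Ising3DConformalLimit.MoebiusLimitExistsOneMapOneJet

end
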